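import Literature.Computability.MetaComplexity.Hirahara2020.SmallBPYesJunta
import Literature.Computability.Complexity.CircuitComposition
import HarnessLib

/-!
# Referee F34, sharpened and PROVED: the FIRST rendering `Hirahara2020.DSPACEvsApproxSIZE c α ρ`
# (YES = `smallBPYes c`) is, at every large length, a DISJOINT promise problem — unlike print's
# `DSPACE(cn)/ₙ cn vs S̃IZE(2^{αn}; 2^{−ραn})`, which Hirahara (ToC 19(4) 2023, title and §4.8)
# stresses is NON-disjoint in general

Companion of `Hirahara2020/SmallBPYesJunta.lean` (every YES instance of rendering (I) is a junta on
`≤ c·n/⌊log₂ n⌋` variables).  Here the junta is turned into a SMALL CIRCUIT with the tree's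
gate-list calculus (`Complexity/CircuitComposition.lean`: `cktSize_univ`, `CktSize.rewire`,
`CktSize.toCircuit`, Arora–Barak Claim 2.13), and the NO side `approxHardNo α ρ` (every `B₂`-circuit
with `≤ ⌊N^α⌋` gates errs on MORE than `N^{1−ρα}` inputs) is seen to exclude it:

* `Hirahara2020.exists_circuit_of_junta` — a function depending only on `S` has a `B₂`-circuit with
  `≤ univBound |S| ≤ 2^{|S|+3}` gates computing it exactly;
* `Hirahara2020.eventually_univBound_le_powThreshold` — for `α > 0`, eventually in `n`,
  `univBound k ≤ ⌊(2^n)^α⌋` for every `k ≤ c·n/⌊log₂ n⌋` (the junta circuits fit under the NO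
  side's size bound);
* `Hirahara2020.eventually_smallBPYes_disjoint_approxHardNo` — hence for every `c`, every `α > 0`
  and every `ρ`: for all large `n`, NO string of length `2^n` is both a YES and a NO instance of
  rendering (I); packaged as `eventually_disjoint_DSPACEvsApproxSIZE`.

Reading (census R28, F34/F36): print's promise problem is allowed to be non-disjoint — the case in
which Thm. 1.13's hypothesis holds for the trivial reason that nothing (co-)solves a non-disjoint
problem; print proves Thm. 1.13 by contraposition (p. 45 L2–9: "We prove the contrapositive of
Theorem 1.13 […] we present a coRP-type randomized read-once branching program that solves
(Π_Yes, Π_No) := (DSPACE(cn)/ₙ cn vs S̃IZE(2^{αn}; 2^{−ραn}))"), so a failure of the conclusion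
would force disjointness.  Rendering (I) NEVER enters the non-disjoint case, so its hypothesis
`Thm113Hypothesis ρ α β c` is, at every large length, a genuine read-once lower bound for a
disjoint promise problem — more than print asks (admissible direction for a NAMED FACT, as
recorded; the row's verdict is unchanged).  The second rendering
(`dlYes`, D13) is not touched by this argument (its YES side contains every bounded-hardware
linear-space slice, `truthTable_slice_mem_dlYes`).  Everything here is proved; no definition, no
named fact; nothing bears on the summit.
-/

namespace Literature.Computability.MetaComplexity

open Finset Filter
open Literature.Computability.Complexity
open UniversalMachine

namespace Hirahara2020

/-- Closed form bound for the universal circuit size: `univBound k ≤ 2^{k+3}`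
(`univBound k = 5·2ᵏ − 4`). [cite: AroraBarakCC2009, Claim 2.13] -/
theorem univBound_le_two_pow (k : ℕ) : univBound k ≤ 2 ^ (k + 3) := by
  have h : univBound k + 4 = 5 * 2 ^ k := by
    induction k with
    | zero => simp [univBound]
    | succ k ih => simp only [univBound, pow_succ]; omega
  have : 2 ^ (k + 3) = 8 * 2 ^ k := by rw [pow_add]; ring
  omega

/-- **A junta has a small circuit.** If `f : {0,1}ⁿ → {0,1}` depends only on the coordinates in
`S`, some `B₂`-circuit with at most `univBound |S|` gates computes `f` exactly (compose the
universal circuit for the core function on `S` with the free projection onto `S`).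
[cite: AroraBarakCC2009, Claim 2.13] -/
theorem exists_circuit_of_junta {n : ℕ} (f : (Fin n → Bool) → Bool) (S : Finset (Fin n))
    (hS : ∀ v w : Fin n → Bool, (∀ i ∈ S, v i = w i) → f v = f w) :
    ∃ C : Circuit (Fin n), C.IsOver B2 ∧ C.size ≤ univBound S.card ∧ ∀ x, C.eval x = f x := by
  classical
  let ext : (↥S → Bool) → (Fin n → Bool) := fun u i => if h : i ∈ S then u ⟨i, h⟩ else false
  have h1 : CktSize B2 (fun (x : Fin n → Bool) (_ : Unit) => f x) (univBound S.card) := by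
    have h := (cktSize_univ (fun (u : ↥S → Bool) (_ : Unit) => f (ext u))).rewire
      (Subtype.val : ↥S → Fin n)
    simp only [Fintype.card_coe] at h
    refine h.congr fun x _ => hS _ _ fun i hi => ?_
    simp [ext, hi]
  obtain ⟨C, hB, hs, he⟩ := h1.toCircuit
  exact ⟨C, hB, hs, fun x => he x⟩

/-- **The junta circuits fit under the NO side's size bound, eventually.** For `α > 0`: for all
large `n` and every `k ≤ c·n/⌊log₂ n⌋`, `univBound k ≤ ⌊(2^n)^α⌋`. [folklore] -/
theorem eventually_univBound_le_powThreshold (c : ℕ) {α : ℝ} (hα : 0 < α) :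
    ∀ᶠ n : ℕ in atTop, ∀ k : ℕ, k ≤ c * n / Nat.log 2 n →
      univBound k ≤ powThreshold α (2 ^ n) := by
  -- a denominator `d` with `c/d ≤ α/2`
  obtain ⟨d, hd1, hd⟩ : ∃ d : ℕ, 1 ≤ d ∧ (c : ℝ) / d ≤ α / 2 := by
    refine ⟨⌈2 * (c : ℝ) / α⌉₊ + 1, by omega, ?_⟩
    have h1 : 2 * (c : ℝ) / α ≤ (⌈2 * (c : ℝ) / α⌉₊ : ℝ) := Nat.le_ceil _
    rw [div_le_iff₀ hα] at h1
    have hpos : (0 : ℝ) < ((⌈2 * (c : ℝ) / α⌉₊ + 1 : ℕ) : ℝ) := by positivity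
    rw [div_le_iff₀ hpos]
    push_cast
    nlinarith [hα.le]
  filter_upwards [eventually_ge_atTop (2 ^ d), eventually_ge_atTop ⌈6 / α⌉₊] with n hn hn6 k hk
  have hlog : d ≤ Nat.log 2 n := Nat.le_log_of_pow_le (by norm_num) hn
  have hk' : k ≤ c * n / d := hk.trans (Nat.div_le_div_left hlog (by omega))
  have hn0 : (0 : ℝ) ≤ n := Nat.cast_nonneg n
  have hkR : (k : ℝ) ≤ α / 2 * n := by
    have h1 : ((c * n / d : ℕ) : ℝ) ≤ ((c * n : ℕ) : ℝ) / (d : ℝ) := Nat.cast_div_le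
    have h2 : ((c * n : ℕ) : ℝ) / (d : ℝ) = (c : ℝ) / d * n := by push_cast; ring
    calc (k : ℝ) ≤ ((c * n / d : ℕ) : ℝ) := by exact_mod_cast hk'
      _ ≤ (c : ℝ) / d * n := by rw [← h2]; exact h1
      _ ≤ α / 2 * n := by gcongr
  have h6 : (6 / α : ℝ) ≤ n := (Nat.le_ceil _).trans (by exact_mod_cast hn6)
  have h3 : (3 : ℝ) ≤ α / 2 * n := by
    rw [div_le_iff₀ hα] at h6
    nlinarith
  have hexp : (((k + 3 : ℕ) : ℝ)) ≤ α * n := by push_cast; linarith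
  refine (univBound_le_two_pow k).trans (Nat.le_floor ?_)
  have hN : (((2 ^ n : ℕ) : ℝ)) ^ α = (2 : ℝ) ^ (α * n) := by
    push_cast
    rw [← Real.rpow_natCast, ← Real.rpow_mul (by norm_num), mul_comm]
  rw [hN, Nat.cast_pow, Nat.cast_ofNat, ← Real.rpow_natCast]
  exact Real.rpow_le_rpow_of_exponent_le (by norm_num) hexp

/-- **Rendering (I) is eventually DISJOINT.** For every `c`, every `α > 0` and every `ρ`: for all
large `n`, no string of length `2^n` lies in both `smallBPYes c` and `approxHardNo α ρ` (a YES
instance is a `(c·n/⌊log₂ n⌋)`-junta, hence has an exact circuit of `≤ ⌊(2^n)^α⌋` gates, whereas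
a NO instance is missed by every such circuit on more than `(2^n)^{1−ρα} ≥ 0` inputs). [folklore] -/
theorem eventually_smallBPYes_disjoint_approxHardNo (c : ℕ) {α : ℝ} (hα : 0 < α) (ρ : ℝ) :
    ∀ᶠ n : ℕ in atTop, ∀ x : List Bool, x.length = 2 ^ n →
      x ∈ smallBPYes c → x ∉ approxHardNo α ρ := by
  filter_upwards [eventually_univBound_le_powThreshold c hα] with n hn x hx hyes hno
  obtain ⟨n₁, f, rfl, P, hP, hPf⟩ := hyes
  have h1 : n = n₁ := Nat.pow_right_injective le_rfl (by simpa using hx.symm)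
  subst h1
  obtain ⟨n₂, f₂, hx₂, hhard⟩ := hno
  have h2 : n = n₂ := Nat.pow_right_injective le_rfl (by simpa using congrArg List.length hx₂)
  subst h2
  have hf : f = f₂ := truthTable_injective hx₂
  subst hf
  obtain ⟨C, hB, hs, he⟩ := exists_circuit_of_junta f ((univ : Finset (Fin P.m)).image P.var)
    (fun v w hvw => by rw [← hPf v, ← hPf w]; exact P.eval_eq_of_agree_on_vars hvw)
  have hsize : C.size ≤ powThreshold α (2 ^ n) := hs.trans (hn _ (P.card_vars_le.trans hP))
  have hlt := hhard C hB hsize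
  have hzero : (#{v : Fin n → Bool | C.eval v ≠ f v} : ℝ) = 0 := by simp [he]
  rw [hzero] at hlt
  exact absurd hlt (not_lt.2 (Real.rpow_nonneg (by positivity) _))

/-- The same, stated for the promise problem `DSPACEvsApproxSIZE c α ρ` of rendering (I): on every
large length slice its YES and NO sides are disjoint. [folklore] -/
theorem eventually_disjoint_DSPACEvsApproxSIZE (c : ℕ) {α : ℝ} (hα : 0 < α) (ρ : ℝ) :
    ∀ᶠ n : ℕ in atTop, ∀ x : List Bool, x.length = 2 ^ n →
      ¬ (x ∈ (DSPACEvsApproxSIZE c α ρ).yes ∧ x ∈ (DSPACEvsApproxSIZE c α ρ).no) := by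
  filter_upwards [eventually_smallBPYes_disjoint_approxHardNo c hα ρ] with n hn x hx h
  exact hn x hx h.1 h.2

end Hirahara2020

end Literature.Computability.MetaComplexity
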